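import Summits.KontsevichZagierPeriods.KontsevichZagierPeriods.Theorems.KzOnePeriodsE1DerivSpan
import Summits.KontsevichZagierPeriods.KontsevichZagierPeriods.Theorems.KzOnePeriodsE1DerivRealLogs

/-!
# KontsevichZagierPeriods — kz1p class E1 derivations, part 3: the interface used by the case files

Cell pub-kz1p (KZ 1-periods), seat b2b-kz1p-2 (IMPLEMENTER), gen 13; helper of the rung-1 item
`stmt-KontsevichZagierPeriods-4990`.  Joins part 1 (`KzOnePeriodsE1DerivSpan`: the symbol-level theorem
`span_zsum_omega` — an integer relation `Σ nₗ mₗ = 0` among algebraic logarithms makes the corresponding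
combination of lifted symbols `(E_L, dx/(2y), φ∘Dₗ)`, `Dₗ : t₀ ↝ t₀ + mₗ`, an element of the `ℚ̄`-span of the
elementary relations (R1)–(R5) at EVERY algebraic base point `t₀`) with part 2 (`KzOnePeriodsE1DerivRealLogs`:
principal real logarithms of rational points and the integer relations among them, decided by the chord /
tangent laws and sign bounds).  Contents:

* `span_real_omega` — `span_zsum_omega` for real logarithms (the form the case files use);
* `exists_base_lifts` — an algebraic base point `t₀` generic for the logarithms, with lifts `t₀ ↝ t₀ + mₗ`
  (so every hypothesis of a case file's `derivation` theorem is satisfiable: its `lifts_exist`);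
* `algLog_of_phi` — a logarithm `u ∉ Λ` with `φ(u) = (x, y)`, `x, y ∈ ℚ̄`, is an algebraic logarithm;
* `evalCombination_zsum_omega` — the value of the combination: `Σ nₗ ∫_{φ∘Dₗ} dx/(2y) = Σ nₗ mₗ`
  (so soundness, [HuberWustholz2022] Thm. 13.3 (2), turns a derivation into the numerical relation);
* `phi_neg_ofReal`, `phi_half_of_eq` — negatives of points and the rational 2-torsion point `(e₁, 0)`;
* `weierstrassPRe_half_eq_of_root_quad` — the `e₁`-certificate for a cubic with one rational root and an
  irreducible quadratic factor (`e₁ = r` when `4x³ − g₂x − g₃ = 4(x − r)(x² + px + q)`, `p² < 4q`).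

References: [HuberWustholz2022] §13.1 (pp. 119–121), Thm. 13.3 (p. 121), §18.1 (pp. 160–161);
[Lawden1989] §§6.7, 6.11; [KontsevichZagier2001] §1.2 (the three moves).
-/

noncomputable section

open MvPolynomial Set Complex
open Literature.NumberTheory.Transcendental Literature.NumberTheory.Transcendental.CurvePeriods
open Literature.NumberTheory.Transcendental.CurvePeriods.Ell
open scoped PeriodPair

namespace Summit.KontsevichZagierPeriods.KzOnePeriods.E1LiftDerivation

open E1RealLogs

/-- `c ∈ ⟨(R1)–(R5)⟩_ℚ̄`: `c` is a `ℚ̄`-linear combination of elementary relations. -/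
local notation3 "InSpanRel " c:arg => ∃ (k : ℕ) (ρ : Fin k → (PeriodSymbol →₀ ℂ))
  (a : Fin k → ℂ), (∀ i, IsElementaryRelation (ρ i)) ∧ (∀ i, IsAlgebraic ℚ (a i)) ∧
    c = ∑ i, a i • ρ i

variable {L : PeriodPair} (h₂ : IsAlgebraic ℚ L.g₂) (h₃ : IsAlgebraic ℚ L.g₃)

/-- The kz1p symbol `(E_L, ½θ₀, φ∘D)` of a lift `D` (form `ω = dx/(2y)`). -/
local notation3 (prettyPrint := false) "Sω[" D "]" =>
  LiftData.sym h₂ h₃ D ((1 / 2 : ℂ) • theta0 L) (hasAlgCoeffs_half_theta0 h₂ h₃)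

include h₂ h₃ in
/-- **Integer relations among real algebraic logarithms lift to (R1)–(R5)**: if `m₁, …, m_r ∈ ℝ` are
algebraic logarithms (`mₗ ∈ Λ` or `φ(mₗ) ∈ E_L(ℚ̄)`) with `Σ nₗ mₗ = 0` (`nₗ ∈ ℤ`), then for every algebraic
base point `t₀` and all lifts `Dₗ : t₀ ↝ t₀ + mₗ`, `Σ nₗ (E_L, dx/(2y), φ∘Dₗ) ∈ ⟨(R1)–(R5)⟩_ℚ̄`.
[cite: HuberWustholz2022, §13.1 (B) (p. 120), §18.1 (pp. 160–161)] -/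
theorem span_real_omega {r : ℕ} (m : Fin r → ℝ) (hm : ∀ l, AlgLog L (m l : ℂ)) (n : Fin r → ℤ)
    (hsum : ∑ l, (n l : ℝ) * m l = 0) {t₀ : ℂ} (ht₀ : IsAlgPt L t₀)
    (D : ∀ l, LiftData L t₀ (t₀ + (m l : ℂ))) :
    InSpanRel (∑ l, (n l : ℂ) • Sω[D l]) :=
  span_zsum_omega h₂ h₃ (fun l => (m l : ℂ)) hm n
    (by have e := congrArg (fun x : ℝ => (x : ℂ)) hsum; push_cast at e; exact e) ht₀ D

include h₂ h₃ in
/-- **Base points and lifts exist**: for algebraic logarithms `m₁, …, m_r` there is an algebraic base point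
`t₀` (a torsion point) with `t₀ + mₗ ∉ Λ` for all `l`, hence lifts `Dₗ : t₀ ↝ t₀ + mₗ` of paths on `E_L`
(`exists_generic_algPt`, `LiftData.nonempty`). [cite: HuberWustholz2022, §18.1 (p. 160)] -/
theorem exists_base_lifts {r : ℕ} (m : Fin r → ℂ) (hm : ∀ l, AlgLog L (m l)) :
    ∃ t₀ : ℂ, IsAlgPt L t₀ ∧ ∀ l, Nonempty (LiftData L t₀ (t₀ + m l)) := by
  classical
  obtain ⟨t₀, ht₀, hB⟩ :=
    exists_generic_algPt L h₂ h₃ (Finset.univ.image fun l => -m l)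
  refine ⟨t₀, ht₀, fun l => ?_⟩
  have hl : t₀ + m l ∉ L.lattice := by
    simpa [sub_neg_eq_add] using hB (-m l) (Finset.mem_image_of_mem _ (Finset.mem_univ l))
  exact LiftData.nonempty ht₀ ((ht₀.algLog.add L h₂ (hm l)).isAlgPt hl)

/-- **Rational points give algebraic logarithms**: `u ∉ Λ`, `φ(u) = (x, y)` with `x, y` algebraic.
[cite: HuberWustholz2022, §18.1 (p. 160)] -/
theorem algLog_of_phi {u : ℂ} (hu : u ∉ L.lattice) {x y : ℂ} (hx : IsAlgebraic ℚ x)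
    (hy : IsAlgebraic ℚ y) (h : phi L u = ![x, y]) : AlgLog L u :=
  (isAlgPt_of_phi_eq₂ hu hx hy h).algLog

include h₂ h₃ in
/-- **The value of the combination**: `Σ nₗ ∫_{φ∘Dₗ} dx/(2y) = Σ nₗ mₗ` for lifts `Dₗ : t₀ ↝ t₀ + mₗ`.
[cite: HuberWustholz2022, §18.1 (p. 160)] -/
theorem evalCombination_zsum_omega {r : ℕ} (m : Fin r → ℂ) (n : Fin r → ℂ) {t₀ : ℂ}
    (D : ∀ l, LiftData L t₀ (t₀ + m l)) :
    evalCombination (∑ l, n l • Sω[D l]) = ∑ l, n l * m l := by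
  rw [evalCombination_finsetSum]
  exact Finset.sum_congr rfl fun l _ => by
    rw [evalCombination_smul, evalCombination_sym_omega, add_sub_cancel_left]

include h₂ h₃ in
/-- **Soundness applied**: a derivation of `Σ nₗ (E_L, dx/(2y), φ∘Dₗ)` from (R1)–(R5) forces the numerical
relation `Σ nₗ mₗ = 0`. [cite: HuberWustholz2022, Thm. 13.3 (2) (p. 121)] -/
theorem zsum_eq_zero_of_span {r : ℕ} (m : Fin r → ℂ) (n : Fin r → ℂ) {t₀ : ℂ}
    (D : ∀ l, LiftData L t₀ (t₀ + m l)) (h : InSpanRel (∑ l, n l • Sω[D l])) :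
    ∑ l, n l * m l = 0 := by
  rw [← evalCombination_zsum_omega h₂ h₃ m n D]
  exact G0Derivation.evalCombination_eq_zero_of_span h

/-- The negative of a point: `φ(−u) = (x, −y)` for a real logarithm `u` with `φ(u) = (x, y)`.
[cite: SilvermanAEC2009, III.2.3] -/
theorem phi_neg_ofReal {u : ℝ} {x y y' : ℂ} (h : phi L u = ![x, y]) (hy : y' = -y) :
    phi L ((-u : ℝ) : ℂ) = ![x, y'] := by
  have e1 : ℘[L] u = x := by simpa using congrFun h 0
  have e2 : ℘'[L] u / 2 = y := by simpa using congrFun h 1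
  rw [ofReal_neg, phi_neg, e1, e2, hy]

/-- The rational 2-torsion point of the identity component: `φ(Ω₁/2) = (e₁, 0)` with `e₁ = r` certified.
[cite: Lawden1989, §6.7] -/
theorem phi_half_of_eq (h : L.IsReal) {r : ℝ} (he : L.weierstrassPRe (L.minRealPeriod / 2) = r) :
    phi L ((L.minRealPeriod / 2 : ℝ) : ℂ) = ![(r : ℂ), 0] := by
  rw [phi_half_period h, he]

/-- **One rational root**: if `4x³ − g₂x − g₃ = 4(x − r)(x² + px + q)` with `p² < 4q` then `e₁ = ℘(Ω₁/2) = r`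
(`e₁` is a real root and the quadratic factor has none). [cite: Lawden1989, §6.11] -/
theorem weierstrassPRe_half_eq_of_root_quad (h : L.IsReal) {r p q : ℝ} (hpq : p ^ 2 < 4 * q)
    (hf : ∀ x, 4 * x ^ 3 - L.g₂.re * x - L.g₃.re = 4 * (x - r) * (x ^ 2 + p * x + q)) :
    L.weierstrassPRe (L.minRealPeriod / 2) = r := by
  set e := L.weierstrassPRe (L.minRealPeriod / 2)
  have he : 4 * (e - r) * (e ^ 2 + p * e + q) = 0 := by rw [← hf]; exact h.cubic_weierstrassPRe_half
  have hq : 0 < e ^ 2 + p * e + q := by nlinarith [sq_nonneg (e + p / 2)]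
  rcases mul_eq_zero.1 he with h1 | h1
  · rcases mul_eq_zero.1 h1 with h2 | h2
    · norm_num at h2
    · exact sub_eq_zero.1 h2
  · exact absurd h1 hq.ne'

end Summit.KontsevichZagierPeriods.KzOnePeriods.E1LiftDerivation

end
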